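import Summits.QuantumFields.YangMills.Theorems.BalabanUVNodesN11TkReadingSupport
import Literature.MathematicalPhysics.QuantumFieldTheory.Balaban1983to89.Node00.TkFirstStepRegionVanishing

/-!
# DAG node N11 — ONE GENERATION OF 11a's `𝐓` READS ITS OPERAND ONLY ON THE AVERAGING FIBRE (a.e. in the coarse variables): the first brick of the fibre refinement of
# the reading support (the door to the (7)-data row's mixed-field clauses)

HEADER — WORK-UNIT METADATA.  Cell `pub-ymgap`, YM-PLAN Track A (HUMAN RULING D-0062), seat `pub-ymgap-dag-n11-d` (g12; R134 fan-out seat N11 [B14], strategy s2),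
route `BalabanUVNodes`, item K1⁷ `StabilityBAtRecordR13SepCoPH` = stmt-QuantumFields-20542 (helper, `--kind proof --supports 20542 --as helper`, count-neutral).
[III] = [Balaban1988Convergent], [B7] = [Balaban1985Averaging].  Over p589098 `…N11TkReadingSupport` (`genOp_congr_supp`: a generation reads its operand only where `ζ ≠ 0 ∧ w ≠ 0`,
POINTWISE), 11a `Node00/TkOfRecord` (`genOp`, `vOp`, `kernelRT`, `genDataOfRecord`), `T4AveragingDisintegration` (`kernelTransport`, `condLaw_fibre_ae`, `margDensity`) and g6's
`Node00/TkFirstStepRegionVanishing` (`kernelTransport_ae_forall_eq_zero_of_fibre` — the AC-free fibre vanishing; `measurePreserving_restrict_fieldMeasure`).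

WHY THIS FILE (the next door, located in `…N11Data7TopZeroOfRead` ∕ HANDOFF §g12).  The (7)-data row's clauses at levels `1 ≤ m+1 ≤ k` read the MIXED field (`W_{m+1}` on the
`Λ`-bonds, `avg(W_m)` on the outer bonds); they follow from per-level regularities only together with the FIBRE IDENTITY `avg(W_m) = W_{m+1}` on the outer bonds — which holds on the
support of 11a's kernel transport, but only ALMOST EVERYWHERE in the coarse variables (the conditional law gives full mass to the fibre `(avg_*ν)`-a.e., `condLaw_fibre_ae`).  The
reading-support theorems of p589098 are pointwise and fibre-blind.  This file proves the ONE-GENERATION a.e. fibre reading: for product-Haar-a.e. coarse restriction `y′`, two operands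
agreeing at the configurations `ω_{y,a}` with `ζ ≠ 0`, `w ≠ 0` AND `avg y = y′` have the same `𝐓^{(j)}`-image at every `ω` over `y′` — the brick from which the multi-generation a.e.
reading support (induction over generations, null sets transported by disintegration, AC-free at `margDensity = 0`) is to be built.

WHAT THIS FILE PROVES (0 `sorry`, 0 `def`).
* ★ `kernelTransport_ae_congr_of_fibre` — generic: `μ`-a.e. in the coarse point, integrands agreeing on the fibre have the same kernel transport (AC-free; no integrability).
* `kernelRT_ae_congr_of_fibre` — the same for 11a's restricted kernel transport `kernelRT avg` (product Haar on both sides).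
* ★★ `genOp_congr_supp_fibre_of_good` — for a generation whose transport IS `kernelRT avg`: at a configuration `ω` whose coarse restriction is a GOOD point (the congruence property
  of `kernelRT_ae_congr_of_fibre`), operands agreeing on `{ζ ≠ 0} ∩ {w ≠ 0} ∩ {avg y = ω_{j+1}|_{sV′}}` have the same `genOp`-image.
* ★★ `genOp_genDataOfRecord_congr_supp_fibre_ae` — at 11a's generation data of record (`vT = kernelRT (avgRestrOfRecord …)`): for `fieldMeasure`-a.e. scale-`(j+1)` gauge field
  `V`, at EVERY `ω` with `(ω (j+1)).1 = V`, the fibre-refined congruence holds.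

HONEST FRAMING.  Helper lane of K1⁷; generic measure theory over 11a's objects; nothing of Bałaban's is asserted; the multi-generation a.e. reading support and the (7)-data clauses at
levels `≥ 1` are NOT proved here (located next steps).  N11 NOT discharged; K1⁷ NOT closed; counts unmoved (typed 28∕28 · discharged 5∕27).  One finite four-torus programme at fixed
`ε = L^{−K}` — NOT ℝ⁴, NOT OS, NOT a mass gap, NOT Clay.  No `sorry`, `axiom`, `def`, `instance`, `notation`.  Sources (SHAPE only): [III] (2.20)–(2.21) p.258, (3.24) p.270;
[B7] (9)–(10) p.19.
-/

noncomputable section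

open MeasureTheory
open scoped BigOperators ENNReal NNReal Matrix.Norms.L2Operator

universe u

namespace Summit.QuantumFields.YangMills.Theorems.BalabanUVNodesN11TkFibreReading

open Literature.MathematicalPhysics.QuantumFieldTheory.Balaban1983to89 T4Continuum Node00 Node00.Tk
open T4AveragingDisintegration (kernelTransport condLaw margDensity jointLaw condLaw_fibre_ae jointLaw_fst)
open T4AdjointCovariance (insA)
open B15DeterminingSets B10Eq42TorusConstraint

/-! ## §1  Generic: a.e. in the coarse point, the kernel transport reads the integrand only on the fibre -/

section Generic

variable {α β : Type*} [MeasurableSpace α] [MeasurableSpace β] [StandardBorelSpace β] [Nonempty β]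

/-- **★ AC-FREE FIBRE READING**: for `μ`-almost every coarse point `y`, ANY two integrands that agree on the fibre `{U | avg U = y}` have the same kernel transport at `y`.
Where the marginal density `d(avg_*ν)∕dμ` vanishes the transport is `0` for both; on its support the conditional law gives full mass to the fibre (`condLaw_fibre_ae` is
`avg_*ν`-a.e., and `μ.withDensity (d(avg_*ν)∕dμ) ≤ avg_*ν` transfers the null set).  No absolute continuity, no integrability (`integral_congr_ae`).
[cite: Balaban1985Averaging, (10) p.19 (bookkeeping); Balaban1988Convergent, (2.21) p.258] -/
theorem kernelTransport_ae_congr_of_fibre (ν : Measure β) [IsFiniteMeasure ν] (μ : Measure α) [SigmaFinite μ] {avg : β → α}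
    (havg : Measurable avg) [MeasurableEq α] :
    ∀ᵐ y ∂μ, ∀ f g : β → ℝ, (∀ U, avg U = y → f U = g U) → kernelTransport ν μ avg f y = kernelTransport ν μ avg g y := by
  have hfib := condLaw_fibre_ae ν havg
  have hle : μ.withDensity ((ν.map avg).rnDeriv μ) ≤ ν.map avg := Measure.withDensity_rnDeriv_le _ _
  have h1 : ∀ᵐ y ∂μ.withDensity ((ν.map avg).rnDeriv μ), condLaw ν avg y {U | avg U = y} = 1 :=
    (Measure.absolutelyContinuous_of_le hle).ae_le hfib
  rw [ae_withDensity_iff (Measure.measurable_rnDeriv _ _)] at h1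
  filter_upwards [h1] with y hy f g hfg
  unfold kernelTransport
  by_cases h0 : margDensity ν μ avg y = 0
  · rw [h0, NNReal.coe_zero, zero_mul, zero_mul]
  · have hr : (ν.map avg).rnDeriv μ y ≠ 0 := by
      intro h
      apply h0
      show ((jointLaw ν avg).fst.rnDeriv μ y).toNNReal = 0
      rw [jointLaw_fst ν havg, h, ENNReal.toNNReal_zero]
    have hfull := hy hr
    have hS : MeasurableSet {U : β | avg U = y} := measurableSet_eq_fun havg measurable_const
    have hc : condLaw ν avg y {U : β | avg U = y}ᶜ = 0 := (prob_compl_eq_zero_iff hS).2 hfull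
    have hae : ∀ᵐ U ∂(condLaw ν avg y), f U = g U := by
      have hmem : ∀ᵐ U ∂(condLaw ν avg y), U ∈ {U : β | avg U = y} := mem_ae_iff.2 hc
      exact hmem.mono fun U hU => hfg U hU
    rw [integral_congr_ae hae]

end Generic

/-! ## §2  11a's restricted kernel transport and one generation -/

section OneGen

variable {G : Type u} [GaugeGroup G] [MeasurableSpace G] [HaarData G] [StandardBorelSpace G]

/-- **THE a.e. FIBRE READING OF 11a's RESTRICTED KERNEL TRANSPORT**: for product-Haar-a.e. coarse configuration `y′`, integrands agreeing on `avg⁻¹{y′}` have the same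
`kernelRT avg`-image at `y′`. [cite: Balaban1988Convergent, (2.21) p.258 (bookkeeping)] -/
theorem kernelRT_ae_congr_of_fibre {ι ι' : Type*} [Fintype ι] [Fintype ι'] [MeasurableEq (ι' → G)] {avg : (ι → G) → (ι' → G)}
    (havg : Measurable avg) :
    ∀ᵐ y' ∂(Measure.pi fun _ : ι' => (HaarData.haar : Measure G)),
      ∀ f g : (ι → G) → ℝ, (∀ y, avg y = y' → f y = g y) → kernelRT avg f y' = kernelRT avg g y' :=
  kernelTransport_ae_congr_of_fibre _ _ havg

variable {P : Params} {V : Type u} [NormedAddCommGroup V] [InnerProductSpace ℝ V] [FiniteDimensional ℝ V] [MeasurableSpace V] [BorelSpace V]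

/-- **★★ ONE GENERATION `𝐓^{(j)}` WITH THE KERNEL TRANSPORT READS ITS OPERAND ONLY WHERE `ζ_j ≠ 0`, `w_j ≠ 0` AND ON THE AVERAGING FIBRE** — at every configuration `ω` whose
coarse restriction `ω_{j+1}|_{sV′}` is a GOOD point of the transport (the congruence property of `kernelRT_ae_congr_of_fibre`, which holds product-Haar-a.e.): if `F ω″ = F′ ω″` at
every `ω″ = ω_{y,a}` with `ζ(ω_y) ≠ 0`, `w(ω_{y,a}) ≠ 0` and `avg y = ω_{j+1}|_{sV′}`, then `𝐓^{(j)}F ω = 𝐓^{(j)}F′ ω` (p589098's `genOp_congr_supp` with the fibre clause ADDED).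
[cite: Balaban1988Convergent, (2.20)–(2.21) p.258] -/
theorem genOp_congr_supp_fibre_of_good {j : ℕ} {hdec : DecidableEq (PBond P j)} (D : GenData P G V j) {avg : (↥D.sV → G) → (↥D.sV' → G)}
    (hT : D.vT = kernelRT avg) {F F' : MultiCfg P G V → ℝ} (ω : MultiCfg P G V)
    (hgood : ∀ f g : (↥D.sV → G) → ℝ, (∀ y, avg y = (fun b : ↥D.sV' => (ω (j + 1)).1 (b : PBond P (j + 1))) → f y = g y) →
      kernelRT avg f (fun b : ↥D.sV' => (ω (j + 1)).1 (b : PBond P (j + 1))) = kernelRT avg g (fun b : ↥D.sV' => (ω (j + 1)).1 (b : PBond P (j + 1))))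
    (h : ∀ (y : ↥D.sV → G) (a : ↥D.sA → V), avg y = (fun b : ↥D.sV' => (ω (j + 1)).1 (b : PBond P (j + 1))) →
      D.ζ (Function.update ω j (Function.updateFinset (ω j).1 D.sV y, (ω j).2)) ≠ 0 →
      D.w (Function.update (Function.update ω j (Function.updateFinset (ω j).1 D.sV y, (ω j).2)) j
          (insA D.sA a ((Function.update ω j (Function.updateFinset (ω j).1 D.sV y, (ω j).2)) j))) ≠ 0 →
      F (Function.update (Function.update ω j (Function.updateFinset (ω j).1 D.sV y, (ω j).2)) j
          (insA D.sA a ((Function.update ω j (Function.updateFinset (ω j).1 D.sV y, (ω j).2)) j))) =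
      F' (Function.update (Function.update ω j (Function.updateFinset (ω j).1 D.sV y, (ω j).2)) j
          (insA D.sA a ((Function.update ω j (Function.updateFinset (ω j).1 D.sV y, (ω j).2)) j)))) :
    genOp j D F ω = genOp j D F' ω := by
  simp only [genOp_apply, vOp_apply, hT]
  refine hgood _ _ fun y hy => ?_
  simp only [zetaOp_apply]
  by_cases hζ : D.ζ (Function.update ω j (Function.updateFinset (ω j).1 D.sV y, (ω j).2)) = 0
  · rw [hζ, zero_mul, zero_mul]
  · congr 1
    rw [aOp_apply, aOp_apply]
    refine integral_congr_ae (Filter.Eventually.of_forall fun a => ?_)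
    by_cases hw : D.w (Function.update (Function.update ω j (Function.updateFinset (ω j).1 D.sV y, (ω j).2)) j
        (insA D.sA a ((Function.update ω j (Function.updateFinset (ω j).1 D.sV y, (ω j).2)) j))) = 0
    · show D.w _ * F _ = D.w _ * F' _
      rw [hw, zero_mul, zero_mul]
    · show D.w _ * F _ = D.w _ * F' _
      rw [h y a hy hζ hw]

end OneGen

/-! ## §3  At 11a's generation data of record: the good coarse fields have full `fieldMeasure` -/

section Record

variable {F : T4Family} {N : ℕ} [NeZero N] {V : Type} [NormedAddCommGroup V] [InnerProductSpace ℝ V] [FiniteDimensional ℝ V] [MeasurableSpace V] [BorelSpace V]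
variable (ν : Stage7Numerics) (M : ℕ) (g : ℕ → ℝ) (K : ℕ) (W : TkWeights F N V K)

/-- **★★ THE GENERATION OF RECORD READS ITS OPERAND ONLY ON THE AVERAGING FIBRE, FOR a.e. SCALE-`(j+1)` GAUGE FIELD**: for `fieldMeasure`-almost every `V′ : T^{(j+1)}`-field, at
EVERY all-scales configuration `ω` with `(ω (j+1)).1 = V′`, two operands agreeing at the configurations `ω_{y,a}` with `ζ_j(Ω^c_{j+1})(ω_y) ≠ 0`, `w_j(ω_{y,a}) ≠ 0` and
`avgRestrOfRecord … y = V′|_{sV′}` have the same image under 11a's generation `j` of record (any history `s`, branch `S`).  The restriction `V′ ↦ V′|_{sV′}` pushes `fieldMeasure`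
to product Haar (g6 `measurePreserving_restrict_fieldMeasure`), along which §2's good set pulls back. [cite: Balaban1988Convergent, (2.20)–(2.21) p.258, (3.24) p.270] -/
theorem genOp_genDataOfRecord_congr_supp_fibre_ae {k : ℕ} (s : SeqOfRecord F ν M g K k) (S : ℕ → Set (Site (F.P K) 0)) (j : ℕ)
    {hdec : DecidableEq (PBond (F.P K) j)}
    (havg : Measurable (avgRestrOfRecord F N K j (Set.toFinite (bondsIn j (s.Ω (j + 1))ᶜ)).toFinset
      (Set.toFinite (bondsIn (j + 1) (s.Ω (j + 1))ᶜ)).toFinset)) :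
    ∀ᵐ V' ∂fieldMeasure (F.P K) (j + 1) (SU N), ∀ (ω : MultiCfg (F.P K) (SU N) V), (ω (j + 1)).1 = V' →
      ∀ {Φ Φ' : MultiCfg (F.P K) (SU N) V → ℝ},
      (∀ (y : ↥(genDataOfRecord F N V ν M g K W s S j).sV → SU N) (a : ↥(genDataOfRecord F N V ν M g K W s S j).sA → V),
        avgRestrOfRecord F N K j _ _ y = (fun b : ↥(Set.toFinite (bondsIn (j + 1) (s.Ω (j + 1))ᶜ)).toFinset => V' (b : PBond (F.P K) (j + 1))) →
        (genDataOfRecord F N V ν M g K W s S j).ζ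
            (Function.update ω j (Function.updateFinset (ω j).1 (genDataOfRecord F N V ν M g K W s S j).sV y, (ω j).2)) ≠ 0 →
        (genDataOfRecord F N V ν M g K W s S j).w
            (Function.update (Function.update ω j (Function.updateFinset (ω j).1 (genDataOfRecord F N V ν M g K W s S j).sV y, (ω j).2)) j
              (insA (genDataOfRecord F N V ν M g K W s S j).sA a
                ((Function.update ω j (Function.updateFinset (ω j).1 (genDataOfRecord F N V ν M g K W s S j).sV y, (ω j).2)) j))) ≠ 0 →
        Φ (Function.update (Function.update ω j (Function.updateFinset (ω j).1 (genDataOfRecord F N V ν M g K W s S j).sV y, (ω j).2)) j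
            (insA (genDataOfRecord F N V ν M g K W s S j).sA a
              ((Function.update ω j (Function.updateFinset (ω j).1 (genDataOfRecord F N V ν M g K W s S j).sV y, (ω j).2)) j))) =
        Φ' (Function.update (Function.update ω j (Function.updateFinset (ω j).1 (genDataOfRecord F N V ν M g K W s S j).sV y, (ω j).2)) j
            (insA (genDataOfRecord F N V ν M g K W s S j).sA a
              ((Function.update ω j (Function.updateFinset (ω j).1 (genDataOfRecord F N V ν M g K W s S j).sV y, (ω j).2)) j)))) →
      genOp j (genDataOfRecord F N V ν M g K W s S j) Φ ω = genOp j (genDataOfRecord F N V ν M g K W s S j) Φ' ω := by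
  haveI : MeasurableEq (↥((Set.toFinite (bondsIn (j + 1) (s.Ω (j + 1))ᶜ)).toFinset) → SU N) := inferInstance
  have hgood := kernelRT_ae_congr_of_fibre (G := SU N) havg
  have hpull := (measurePreserving_restrict_fieldMeasure (P := F.P K) (j := j + 1) (G := SU N)
    ((Set.toFinite (bondsIn (j + 1) (s.Ω (j + 1))ᶜ)).toFinset)).quasiMeasurePreserving.ae hgood
  filter_upwards [hpull] with V' hV' ω hω Φ Φ' h
  refine genOp_congr_supp_fibre_of_good _ rfl ω (fun f g' hfg => ?_) fun y a hy hζ hw => h y a ?_ hζ hw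
  · have key := hV' f g' fun y hy => hfg y (hy.trans (funext fun b => by rw [hω]))
    simp only [hω]
    exact key
  · rw [hω] at hy
    exact hy

end Record

end Summit.QuantumFields.YangMills.Theorems.BalabanUVNodesN11TkFibreReading

end
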